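import Summits.Ventures.YMGap.RobustBall.OneStateStar
import Summits.Ventures.YMGap.RobustBall.OneStateStarSU3
import Summits.Ventures.YMGap.RobustBall.LoopActionGaugeBall
import HarnessLib

/-!
# Venture YMGap, track ROBUST-BALL — ONE STATE for FINITE-RANGE GENERIC WILSON-TYPE LOOP ACTIONS up to `β_W = 1/3`:
# the unique DLR state IS the periodised torus limit, massive AND area-law

HONEST FRAMING. WHAT THIS IS: a venture file (cell `pub-ymgap`, track Y2 ROBUST-BALL, seat ds-3): the directive's own
object — generic Wilson-type loop actions `S_W + ∑_i c_i Re tr U_{γ_i}/N` over an arbitrary family of closed lattice loops of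
`ℓ^∞`-extent `≤ R` with finitely many loops through every link (rb-p1's `loopFamilyAction`, UNWEIGHTED norm
`‖c‖₀ = sup_e ∑_{i : e ∈ γ_i} |c_i| |γ_i|`) — read through rb-p1's gauge-ball membership `memBallZdG_loopFamilyAction`
(`(loopFamilyAction N γ c, loopSupp γ) ∈ MemBallZdG (2ε) (d ε) R` for `‖c‖₀ ≤ ε`), ds-2's robust vertex-star rows on `ℤ⁴`
and the seat's ONE-STATE schemas (`su2_oneState_of_star_row`, `su3_oneState_of_star_row`). RESULTS (`ℤ⁴`): for each range
`R` one pair `(C, c)`, `c > 0`, such that for EVERY such loop action with `‖c‖₀ ≤ ε(β_W)/4` — `SU(2)`: `β_W = 1/8`,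
`‖c‖₀ ≤ 0.037` (`su2_loops_oneState_oneEighth`); `β_W = 1/4`, `‖c‖₀ ≤ 0.01375`; `β_W = 1/3`, `‖c‖₀ ≤ 0.003`; every
`0 ≤ β_W ≤ 1/3` with `‖c‖₀ ≤ 0.003` (`su2_loops_oneState_upTo_oneThird`); `SU(3)` HYPOTHESIS-FREE: `β_W = 1/8`,
`‖c‖₀ ≤ 0.037` (`su3_loops_oneState_oneEighth`) — there is ONE probability measure which is the unique DLR state of the
action AND the infinite-volume limit of its PERIODISED torus states, an Osterwalder–Seiler massive state with
plaquette–plaquette decay, obeying Wilson's area law `|⟨W(R'×T)⟩| ≤ C^{2(R'+T)} e^{−cR'T}`. Instances: ALL closed trails of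
length `≤ L₀` at once (`su2_trailsLE_oneState_oneEighth`, range `2L₀`). WHAT IT IS NOT: lattice strong coupling; the radii are
door artefacts (a factor `4 = d` from the site-incidence load); existence of the string tension is not claimed; nothing about
the continuum limit or the Clay Millennium problem.

References: rb-p1 `LoopActionGaugeBall.lean`, `LoopActionFiniteRange.lean`, `LoopActionMember.lean`; ds-2
`MassGapOnBallZdGRows.lean`, `MassGapOnBallZdGRowsSUN.lean`; ds-3 `OneStateStar.lean`, `OneStateStarSU3.lean`, `OneState.lean`.
-/

noncomputable section

open MeasureTheory Filter Topology Function Finset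
open scoped NNReal
open Literature.Probability.LatticeModels
open Literature.MathematicalPhysics.QuantumLattice hiding torusNorm
open Literature.MathematicalPhysics.QuantumFieldTheory hiding ZdEdge Site
open Literature.MathematicalPhysics.QuantumFieldTheory (walkEdges)
open Literature.Barriers.QuantumFields (IsMassiveState)

namespace Summit.Ventures.YMGap.RobustBall

variable {ι : Type*}

/-! ### `SU(2)`, `d = 4` -/

section SU2

/-- **`SU(2)`, `d = 4` ONE-STATE SCHEMA FOR LOOP ACTIONS on a star row**: a `MassGapOnBallZdG 4 2 β (2ε) (4ε) R` row at tree
coupling `2β ∈ [0, 1/6]` with `(2ε, 4ε)` inside the UpTo area-law ball `(3/10, 3/20)` gives, for each range `R`, one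
`(C, c)`, `c > 0`: EVERY generic Wilson-type loop action with finite carrier fibres, finitely many loops through every link,
loops of extent `≤ R` and `‖c‖₀ ≤ ε` has ONE state (unique DLR = periodised torus limit), massive with plaquette decay and
`HasAreaLawWith μ χ₂ C c`. [folklore] -/
theorem su2_loops_oneState_of_star_row {β ε : ℝ} {R : ℕ} (hε : 0 ≤ ε) (h₁ : 4 * ε ≤ 3 / 20)
    (hβ0 : 0 ≤ ((2 : ℕ) : ℝ) * β) (hβ : ((2 : ℕ) : ℝ) * β ≤ 1 / 6) (hgap : MassGapOnBallZdG 4 2 β (2 * ε) (4 * ε) R) :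
    ∃ C c : ℝ, 0 < c ∧ ∀ (γ : ι → ZdLoop 4) (cpl : ι → ℝ),
      (∀ X, {i | walkEdges (γ i).walk = X}.Finite) → (∀ e : ZdEdge 4, {i | e ∈ walkEdges (γ i).walk}.Finite) →
      (∀ i, ∀ e ∈ walkEdges (γ i).walk, ∀ y ∈ walkEdges (γ i).walk, ‖e.1 - y.1‖ ≤ (R : ℝ)) → LoopNormLE 0 γ cpl ε →
      ∀ (hdep : ∀ X, DependsOn (loopFamilyAction (d := 4) 2 γ cpl X) (↑X : Set (ZdEdge 4)))
        (hg : ∀ X, IsZdGaugeInvariant (loopFamilyAction (d := 4) 2 γ cpl X))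
        (hm : ∀ X, Measurable (loopFamilyAction (d := 4) 2 γ cpl X))
        (hb : ∀ X, ∃ C, ∀ U, |loopFamilyAction (d := 4) 2 γ cpl X U| ≤ C),
      ∃ μ : Measure (LGConfig 4 (SUN 2)),
        perturbedGibbsMeasures (d := 4) (fundamentalRep (Fin 2)) (((2 : ℕ) : ℝ) * β)
            (loopFamilyAction (d := 4) 2 γ cpl) (loopSupp γ) = {μ} ∧
        perturbedLimitPoints (((2 : ℕ) : ℝ) * β)
            (periodisedFamily (loopFamilyAction (d := 4) 2 γ cpl) (loopSupp γ) hdep hg hm hb) = {μ} ∧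
        IsMassiveState μ ∧ HasExponentialDecay (plaquetteCorrFn (fundamentalRep (Fin 2)) μ) ∧
        HasAreaLawWith μ (fun g => normalisedCharacter 2 (fundamentalRep (Fin 2) g)) C c := by
  obtain ⟨C, c, hc, hA⟩ := su2_oneState_of_star_row (ε₀ := 2 * ε) (ε₁ := 4 * ε) (by linarith) (by linarith)
    (by linarith) h₁ hβ0 hβ hgap
  refine ⟨C, c, hc, fun γ cpl hfin hthr hR h hdep hg hm hb => hA _ _ ?_ hdep hg hm hb⟩
  have hmem := memBallZdG_loopFamilyAction (d := 4) (N := 2) hfin hthr hR h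
  have e4 : ((4 : ℕ) : ℝ) * ε = 4 * ε := by norm_num
  rw [e4] at hmem
  exact hmem

/-- ★ **`SU(2)`, `ℤ⁴`, `β_W = 1/8`: EVERY finite-range generic Wilson-type loop action with `‖c‖₀ ≤ 0.037` has ONE state**
(unique DLR state = limit of its PERIODISED torus states), massive with plaquette–plaquette decay AND area-law — for each
range `R` one `(C, c)` serving every such action of extent `≤ R` (ds-2's star row `su2_massGapOnBallZdG_star_oneEighth` on
`MemBallZdG 0.296 0.148 R` ⊇ `(0.074, 0.148)`; 't Hooft `1/32`). [folklore] -/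
theorem su2_loops_oneState_oneEighth (R : ℕ) :
    ∃ C c : ℝ, 0 < c ∧ ∀ (γ : ι → ZdLoop 4) (cpl : ι → ℝ),
      (∀ X, {i | walkEdges (γ i).walk = X}.Finite) → (∀ e : ZdEdge 4, {i | e ∈ walkEdges (γ i).walk}.Finite) →
      (∀ i, ∀ e ∈ walkEdges (γ i).walk, ∀ y ∈ walkEdges (γ i).walk, ‖e.1 - y.1‖ ≤ (R : ℝ)) →
      LoopNormLE 0 γ cpl (37 / 1000) →
      ∀ (hdep : ∀ X, DependsOn (loopFamilyAction (d := 4) 2 γ cpl X) (↑X : Set (ZdEdge 4)))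
        (hg : ∀ X, IsZdGaugeInvariant (loopFamilyAction (d := 4) 2 γ cpl X))
        (hm : ∀ X, Measurable (loopFamilyAction (d := 4) 2 γ cpl X))
        (hb : ∀ X, ∃ C, ∀ U, |loopFamilyAction (d := 4) 2 γ cpl X U| ≤ C),
      ∃ μ : Measure (LGConfig 4 (SUN 2)),
        perturbedGibbsMeasures (d := 4) (fundamentalRep (Fin 2)) (((2 : ℕ) : ℝ) * (1 / 32))
            (loopFamilyAction (d := 4) 2 γ cpl) (loopSupp γ) = {μ} ∧
        perturbedLimitPoints (((2 : ℕ) : ℝ) * (1 / 32))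
            (periodisedFamily (loopFamilyAction (d := 4) 2 γ cpl) (loopSupp γ) hdep hg hm hb) = {μ} ∧
        IsMassiveState μ ∧ HasExponentialDecay (plaquetteCorrFn (fundamentalRep (Fin 2)) μ) ∧
        HasAreaLawWith μ (fun g => normalisedCharacter 2 (fundamentalRep (Fin 2) g)) C c :=
  su2_loops_oneState_of_star_row (by norm_num) (by norm_num) (by norm_num) (by norm_num)
    ((su2_massGapOnBallZdG_star_oneEighth R).mono (by norm_num) (by norm_num) le_rfl)

/-- **`SU(2)`, `ℤ⁴`, `β_W = 1/4`: every finite-range loop action with `‖c‖₀ ≤ 0.01375` has ONE state, massive and area-law**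
(star row `su2_massGapOnBallZdG_star_oneQuarter` on `MemBallZdG 0.11 0.055 R`; 't Hooft `1/16`). [folklore] -/
theorem su2_loops_oneState_oneQuarter (R : ℕ) :
    ∃ C c : ℝ, 0 < c ∧ ∀ (γ : ι → ZdLoop 4) (cpl : ι → ℝ),
      (∀ X, {i | walkEdges (γ i).walk = X}.Finite) → (∀ e : ZdEdge 4, {i | e ∈ walkEdges (γ i).walk}.Finite) →
      (∀ i, ∀ e ∈ walkEdges (γ i).walk, ∀ y ∈ walkEdges (γ i).walk, ‖e.1 - y.1‖ ≤ (R : ℝ)) →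
      LoopNormLE 0 γ cpl (11 / 800) →
      ∀ (hdep : ∀ X, DependsOn (loopFamilyAction (d := 4) 2 γ cpl X) (↑X : Set (ZdEdge 4)))
        (hg : ∀ X, IsZdGaugeInvariant (loopFamilyAction (d := 4) 2 γ cpl X))
        (hm : ∀ X, Measurable (loopFamilyAction (d := 4) 2 γ cpl X))
        (hb : ∀ X, ∃ C, ∀ U, |loopFamilyAction (d := 4) 2 γ cpl X U| ≤ C),
      ∃ μ : Measure (LGConfig 4 (SUN 2)),
        perturbedGibbsMeasures (d := 4) (fundamentalRep (Fin 2)) (((2 : ℕ) : ℝ) * (1 / 16))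
            (loopFamilyAction (d := 4) 2 γ cpl) (loopSupp γ) = {μ} ∧
        perturbedLimitPoints (((2 : ℕ) : ℝ) * (1 / 16))
            (periodisedFamily (loopFamilyAction (d := 4) 2 γ cpl) (loopSupp γ) hdep hg hm hb) = {μ} ∧
        IsMassiveState μ ∧ HasExponentialDecay (plaquetteCorrFn (fundamentalRep (Fin 2)) μ) ∧
        HasAreaLawWith μ (fun g => normalisedCharacter 2 (fundamentalRep (Fin 2) g)) C c :=
  su2_loops_oneState_of_star_row (by norm_num) (by norm_num) (by norm_num) (by norm_num)
    ((su2_massGapOnBallZdG_star_oneQuarter R).mono (by norm_num) (by norm_num) le_rfl)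

/-- ★★ **`SU(2)`, `ℤ⁴`, `β_W = 1/3` (top of the certified star window): every finite-range loop action with `‖c‖₀ ≤ 0.003`
has ONE state, massive and area-law** (star row `su2_massGapOnBallZdG_star_oneThird` on `MemBallZdG 0.024 0.012 R`; 't Hooft
`1/12`). [folklore] -/
theorem su2_loops_oneState_oneThird (R : ℕ) :
    ∃ C c : ℝ, 0 < c ∧ ∀ (γ : ι → ZdLoop 4) (cpl : ι → ℝ),
      (∀ X, {i | walkEdges (γ i).walk = X}.Finite) → (∀ e : ZdEdge 4, {i | e ∈ walkEdges (γ i).walk}.Finite) →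
      (∀ i, ∀ e ∈ walkEdges (γ i).walk, ∀ y ∈ walkEdges (γ i).walk, ‖e.1 - y.1‖ ≤ (R : ℝ)) →
      LoopNormLE 0 γ cpl (3 / 1000) →
      ∀ (hdep : ∀ X, DependsOn (loopFamilyAction (d := 4) 2 γ cpl X) (↑X : Set (ZdEdge 4)))
        (hg : ∀ X, IsZdGaugeInvariant (loopFamilyAction (d := 4) 2 γ cpl X))
        (hm : ∀ X, Measurable (loopFamilyAction (d := 4) 2 γ cpl X))
        (hb : ∀ X, ∃ C, ∀ U, |loopFamilyAction (d := 4) 2 γ cpl X U| ≤ C),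
      ∃ μ : Measure (LGConfig 4 (SUN 2)),
        perturbedGibbsMeasures (d := 4) (fundamentalRep (Fin 2)) (((2 : ℕ) : ℝ) * (1 / 12))
            (loopFamilyAction (d := 4) 2 γ cpl) (loopSupp γ) = {μ} ∧
        perturbedLimitPoints (((2 : ℕ) : ℝ) * (1 / 12))
            (periodisedFamily (loopFamilyAction (d := 4) 2 γ cpl) (loopSupp γ) hdep hg hm hb) = {μ} ∧
        IsMassiveState μ ∧ HasExponentialDecay (plaquetteCorrFn (fundamentalRep (Fin 2)) μ) ∧
        HasAreaLawWith μ (fun g => normalisedCharacter 2 (fundamentalRep (Fin 2) g)) C c :=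
  su2_loops_oneState_of_star_row (by norm_num) (by norm_num) (by norm_num) (by norm_num)
    ((su2_massGapOnBallZdG_star_oneThird R).mono (by norm_num) (by norm_num) le_rfl)

/-- ★ **`SU(2)`, `ℤ⁴`, EVERY `0 ≤ β_W ≤ 1/3`**: for each range `R` one `(C, c)`, `c > 0`, INDEPENDENT of the coupling in the
window, such that every finite-range loop action with `‖c‖₀ ≤ 0.003` has ONE state, massive and area-law, at every Wilson
coupling `0 ≤ β_W ≤ 1/3` ('t Hooft `β_W/4`; ds-2's `su2_massGapOnBallZdG_star_upTo_oneThird`). [folklore] -/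
theorem su2_loops_oneState_upTo_oneThird (R : ℕ) :
    ∃ C c : ℝ, 0 < c ∧ ∀ βW : ℝ, 0 ≤ βW → βW ≤ 1 / 3 → ∀ (γ : ι → ZdLoop 4) (cpl : ι → ℝ),
      (∀ X, {i | walkEdges (γ i).walk = X}.Finite) → (∀ e : ZdEdge 4, {i | e ∈ walkEdges (γ i).walk}.Finite) →
      (∀ i, ∀ e ∈ walkEdges (γ i).walk, ∀ y ∈ walkEdges (γ i).walk, ‖e.1 - y.1‖ ≤ (R : ℝ)) →
      LoopNormLE 0 γ cpl (3 / 1000) →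
      ∀ (hdep : ∀ X, DependsOn (loopFamilyAction (d := 4) 2 γ cpl X) (↑X : Set (ZdEdge 4)))
        (hg : ∀ X, IsZdGaugeInvariant (loopFamilyAction (d := 4) 2 γ cpl X))
        (hm : ∀ X, Measurable (loopFamilyAction (d := 4) 2 γ cpl X))
        (hb : ∀ X, ∃ C, ∀ U, |loopFamilyAction (d := 4) 2 γ cpl X U| ≤ C),
      ∃ μ : Measure (LGConfig 4 (SUN 2)),
        perturbedGibbsMeasures (d := 4) (fundamentalRep (Fin 2)) (((2 : ℕ) : ℝ) * (βW / 4))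
            (loopFamilyAction (d := 4) 2 γ cpl) (loopSupp γ) = {μ} ∧
        perturbedLimitPoints (((2 : ℕ) : ℝ) * (βW / 4))
            (periodisedFamily (loopFamilyAction (d := 4) 2 γ cpl) (loopSupp γ) hdep hg hm hb) = {μ} ∧
        IsMassiveState μ ∧ HasExponentialDecay (plaquetteCorrFn (fundamentalRep (Fin 2)) μ) ∧
        HasAreaLawWith μ (fun g => normalisedCharacter 2 (fundamentalRep (Fin 2) g)) C c := by
  obtain ⟨C, c, hc, hA⟩ := su2_oneState_star_upTo_oneThird R
  refine ⟨C, c, hc, fun βW h0 h γ cpl hfin hthr hR hn hdep hg hm hb => hA βW h0 h _ _ ?_ hdep hg hm hb⟩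
  have hmem := memBallZdG_loopFamilyAction (d := 4) (N := 2) hfin hthr hR hn
  norm_num at hmem
  exact MemBallZdG.mk hmem.continuous hmem.dependsOn hmem.supportedBy hmem.range hmem.gaugeInvariant
    (by obtain ⟨osc, lip, h1, h2, h3, h4⟩ := hmem.loads
        exact ⟨osc, lip, h1, h2, fun e => (h3 e).trans (by norm_num), fun v => (h4 v).trans (by norm_num)⟩)

/-- ★ **ALL closed trails of length `≤ L₀` at once, `SU(2)`, `ℤ⁴`, `β_W = 1/8`**: one `(C, c)` such that every coupling
function on the closed trails of length `≤ L₀` with `∑_{γ ∋ e} |c_γ| |γ| ≤ 0.037` through every link gives ONE state, massive and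
area-law (range `2L₀`; rb-p1's `memBallZdG_trailsLE`). [folklore] -/
theorem su2_trailsLE_oneState_oneEighth (L₀ : ℕ) :
    ∃ C c : ℝ, 0 < c ∧ ∀ (cpl : TrailIdxLE 4 L₀ → ℝ), LoopNormLE 0 (trailLoopLE L₀) cpl (37 / 1000) →
      ∀ (hdep : ∀ X, DependsOn (loopFamilyAction (d := 4) 2 (trailLoopLE L₀) cpl X) (↑X : Set (ZdEdge 4)))
        (hg : ∀ X, IsZdGaugeInvariant (loopFamilyAction (d := 4) 2 (trailLoopLE L₀) cpl X))
        (hm : ∀ X, Measurable (loopFamilyAction (d := 4) 2 (trailLoopLE L₀) cpl X))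
        (hb : ∀ X, ∃ C, ∀ U, |loopFamilyAction (d := 4) 2 (trailLoopLE L₀) cpl X U| ≤ C),
      ∃ μ : Measure (LGConfig 4 (SUN 2)),
        perturbedGibbsMeasures (d := 4) (fundamentalRep (Fin 2)) (((2 : ℕ) : ℝ) * (1 / 32))
            (loopFamilyAction (d := 4) 2 (trailLoopLE L₀) cpl) (loopSupp (trailLoopLE L₀)) = {μ} ∧
        perturbedLimitPoints (((2 : ℕ) : ℝ) * (1 / 32))
            (periodisedFamily (loopFamilyAction (d := 4) 2 (trailLoopLE L₀) cpl) (loopSupp (trailLoopLE L₀))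
              hdep hg hm hb) = {μ} ∧
        IsMassiveState μ ∧ HasExponentialDecay (plaquetteCorrFn (fundamentalRep (Fin 2)) μ) ∧
        HasAreaLawWith μ (fun g => normalisedCharacter 2 (fundamentalRep (Fin 2) g)) C c := by
  obtain ⟨C, c, hc, hA⟩ := su2_loops_oneState_oneEighth (ι := TrailIdxLE 4 L₀) (2 * L₀)
  exact ⟨C, c, hc, fun cpl h hdep hg hm hb => hA (trailLoopLE L₀) cpl finite_fibre_trailLoopLE finite_through_trailLoopLE
    (fun i e he y hy => by exact_mod_cast norm_sub_le_trailLoopLE i e he y hy) h hdep hg hm hb⟩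

end SU2

/-! ### `SU(3)`, `d = 4`, hypothesis-free -/

section SU3

/-- ★ **`SU(3)`, `ℤ⁴`, `β_W = 1/8`, HYPOTHESIS-FREE: every finite-range generic Wilson-type loop action with `‖c‖₀ ≤ 0.037`
has ONE state** (unique DLR state = periodised torus limit), massive with plaquette–plaquette decay AND area-law, for each
range `R` one `(C, c)` (ds-2's eigen-modulus star row `su3_massGapOnBallZdG_star_oneEighth` on `MemBallZdG 0.296 0.148 R`;
`su3_areaLawOnBall_radius_bePair`; 't Hooft `1/72`). [folklore] -/
theorem su3_loops_oneState_oneEighth (R : ℕ) :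
    ∃ C c : ℝ, 0 < c ∧ ∀ (γ : ι → ZdLoop 4) (cpl : ι → ℝ),
      (∀ X, {i | walkEdges (γ i).walk = X}.Finite) → (∀ e : ZdEdge 4, {i | e ∈ walkEdges (γ i).walk}.Finite) →
      (∀ i, ∀ e ∈ walkEdges (γ i).walk, ∀ y ∈ walkEdges (γ i).walk, ‖e.1 - y.1‖ ≤ (R : ℝ)) →
      LoopNormLE 0 γ cpl (37 / 1000) →
      ∀ (hdep : ∀ X, DependsOn (loopFamilyAction (d := 4) 3 γ cpl X) (↑X : Set (ZdEdge 4)))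
        (hg : ∀ X, IsZdGaugeInvariant (loopFamilyAction (d := 4) 3 γ cpl X))
        (hm : ∀ X, Measurable (loopFamilyAction (d := 4) 3 γ cpl X))
        (hb : ∀ X, ∃ C, ∀ U, |loopFamilyAction (d := 4) 3 γ cpl X U| ≤ C),
      ∃ μ : Measure (LGConfig 4 (SUN 3)),
        perturbedGibbsMeasures (d := 4) (fundamentalRep (Fin 3)) (((3 : ℕ) : ℝ) * ((1 / 8 : ℝ) / 9))
            (loopFamilyAction (d := 4) 3 γ cpl) (loopSupp γ) = {μ} ∧
        perturbedLimitPoints (((3 : ℕ) : ℝ) * ((1 / 8 : ℝ) / 9))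
            (periodisedFamily (loopFamilyAction (d := 4) 3 γ cpl) (loopSupp γ) hdep hg hm hb) = {μ} ∧
        IsMassiveState μ ∧ HasExponentialDecay (plaquetteCorrFn (fundamentalRep (Fin 3)) μ) ∧
        HasAreaLawWith μ (fun g => normalisedCharacter 3 (fundamentalRep (Fin 3) g)) C c := by
  have hgap : MassGapOnBallZdG 4 3 ((1 / 8 : ℝ) / 9) (37 / 500) (37 / 250) R := by
    have h := (su3_massGapOnBallZdG_star_oneEighth R).mono (ε₀' := 37 / 500) (ε₁' := 37 / 250)
      (by norm_num) (by norm_num) le_rfl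
    norm_num at h ⊢; exact h
  obtain ⟨C, c, hc, hA⟩ := su3_oneState_of_star_row (by norm_num) (by norm_num) (by norm_num) (by norm_num)
    (by norm_num) (by norm_num) hgap
  refine ⟨C, c, hc, fun γ cpl hfin hthr hR h hdep hg hm hb => hA _ _ ?_ hdep hg hm hb⟩
  have hmem := memBallZdG_loopFamilyAction (d := 4) (N := 3) hfin hthr hR h
  norm_num at hmem ⊢
  exact hmem

end SU3

end Summit.Ventures.YMGap.RobustBall

end
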